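import Summits.CriticalPhenomena.CardyFormulaZ2.Theorems.CardySusyWardParafermionFamiliesToSLESixWiredPhaseLR

/-!
# The concrete anchor family (skeleton r4 of line `strip-anchored-vertex-normalisation`,
# crux stmt-CriticalPhenomena-10814), VII: the all-closed exploration around the bottom vertex and along
# the lower-left WIRED side

Shared helper file (registered one-line form `stub_anchor_wiredOrbitEmpty`) of the two wired-side phase
packages `stub_anchorWiredPhaseLL` / `stub_anchorWiredPhaseUL` of the stub `stub_anchorMoment_of_IP`. For the
concrete anchor data `E = anchorData δ` at level `L` (`L δ < 2 ≤ (L + 1) δ`; `s = v₀ + v₁`, `d = v₀ - v₁`;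
the sites with `s ∈ {-(L - 1), -L}` form the lower-left side of the wired arc `A`, `…AnchorDataLattice.lean`)
the exploration of the completed ALL-CLOSED configuration `E.bcBondConfig ∅` hugs the wired arc: after the
lower-right side (`AnchorWiredLR.visit_all`, `…WiredPhaseLR.lean`) it turns around the bottom vertex of the
diamond and runs up the lower-left side, swinging clockwise around every boundary face `G` (`s(G) = -L`;
corners `G`, `G + e₀`, `G + e₁` on `A`, `G + e₀ + e₁` inside) through `(G + e₀, 1)`, `(G, 0)`, `(G + e₁, 3)`
with turn counts `-1, -2, -3` — explicit indices and turn counts for the ABSOLUTE anchoring of the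
lower-left (and, continued by the UL package, upper-left) wired phases:

* `orbit_LR_end` — the last leaving dart `((0, -(L-1)), 0)` of the lower-right side is visited, turn
  count `-2` (`AnchorWiredLR.visit_all` with `m = L - 2`);
* `orbit_bottom` — two explicit steps around the bottom vertex: cross the layer edge
  `s((0,-(L-1)),(0,-(L-2)))` to `((0,-(L-1)), 1)` (turn count `-1`; this is the entering dart
  `(G₀ + e₀, 1)` of the first lower-left face `G₀ = (-1,-(L-1))`), follow the frozen-open
  `s((0,-(L-1)),(-1,-(L-1)))` to `(G₀, 0)` (turn count `-2`);
* `shift_LL` — one face up the side every four steps (follow `s(G, G + e₁)`, cross `s(G + e₁, G + e₀ + e₁)`,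
  cross `s(G + e₁, G + 2e₁)`, follow `s(G + e₁, G - e₀ + e₁)`: turns `-1, +1, +1, -1`), from `(G, 0)` to
  `(G - e₀ + e₁, 0)` with the same turn count;
* `orbit_LL`, `orbit_LL_end` — hence every `(G, 0)` of the lower-left side (`s(G) = -L`, `|d(G)| ≤ L - 2`)
  is visited with turn count `-2`, up to the last one `((-(L-1), -1), 0)` before the left vertex.
-/

noncomputable section

namespace Summit.CriticalPhenomena.CardyFormulaZ2.Theorems.ParafermionFamiliesToSLESix.StripAnchored

open MeasureTheory Filter Set Metric
open scoped Topology BigOperators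
open Literature.Probability.LatticeModels
open Literature.Probability.Percolation (bondPercolation half BondConfig)
open Literature.Probability.RandomPlanarGeometry (DobrushinDomain)
open Summit.CriticalPhenomena.CardyFormulaZ2.Theorems.ParafermionPrecompact.Negative (IsFamily VanishesOn)
open Summit.CriticalPhenomena.CardyFormulaZ2.Cruxes.EdgePrecompact.QkzStripBoundaryArm (cornerObs)
open Literature.Probability.LatticeModels.DiscreteDobrushin (startCorner exitTime isStartCorner_startCorner
  isInnerFace_of_lt_exitTime not_isInnerFace_exitTime)
open S5 (anchorDomain)
open S2 (sixthPhase)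

namespace AnchorWiredEmpty

variable {δ : ℝ} {L : ℤ}

section Level

variable (hδ : 0 < δ) (hLδ : (L : ℝ) * δ < 2) (hL1 : 2 ≤ ((L : ℝ) + 1) * δ) (hL : 4 ≤ L)
  (hE : (anchorData δ).IsZdAdmissible)
include hδ hLδ hL1 hL

/-! ## The end of the lower-right side and the bottom vertex -/

/-- **The end of the lower-right side.** The all-closed exploration visits the leaving dart
`((0, -(L-1)), 0)` of the last face `(0, -(L-1))` (`d = L - 1`, `s = -(L - 1)`) of the lower-right wired
side, with turn count `-2` (`AnchorWiredLR.visit_all` with `m = L - 2`). [cite: Smirnov2010, proof of Lemma 4.5] -/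
theorem orbit_LR_end : ∃ n < exitTime hE ∅,
    cornerOrbit ((anchorData δ).bcBondConfig ∅) (startCorner hE) n = ((![0, -(L - 1)] : Site 2), 0) ∧
      turnCount ((anchorData δ).bcBondConfig ∅) (startCorner hE) n = -2 := by
  obtain ⟨m, hm⟩ := Int.eq_ofNat_of_zero_le (show (0 : ℤ) ≤ L - 2 by omega)
  exact AnchorWiredLR.visit_all hδ hLδ hL1 hL hE m _ (by simp) (by simp; omega) (by simp)

/-- **Two explicit steps around the bottom vertex of the diamond.** From a visit
`orb n = ((0, -(L-1)), 0)` (`n < T`) of the all-closed exploration: cross the layer edge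
`s((0,-(L-1)),(0,-(L-2)))` to `orb (n + 1) = ((0,-(L-1)), 1)` — the entering dart `(G₀ + e₀, 1)` of the first
lower-left face `G₀ = (-1,-(L-1))` —, then follow the frozen-open `A`–`A` edge `s((0,-(L-1)),(-1,-(L-1)))` to
`orb (n + 2) = (G₀, 0)`, all before the exit; turn counts `t + 1`, `t`. [cite: Smirnov2001, §2] -/
theorem orbit_bottom {n : ℕ} (hn : n < exitTime hE ∅)
    (h : cornerOrbit ((anchorData δ).bcBondConfig ∅) (startCorner hE) n = ((![0, -(L - 1)] : Site 2), 0)) :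
    n + 2 < exitTime hE ∅ ∧
      cornerOrbit ((anchorData δ).bcBondConfig ∅) (startCorner hE) (n + 1) = ((![0, -(L - 1)] : Site 2), 1) ∧
      cornerOrbit ((anchorData δ).bcBondConfig ∅) (startCorner hE) (n + 2) = ((![-1, -(L - 1)] : Site 2), 0) ∧
      turnCount ((anchorData δ).bcBondConfig ∅) (startCorner hE) (n + 1) =
        turnCount ((anchorData δ).bcBondConfig ∅) (startCorner hE) n + 1 ∧
      turnCount ((anchorData δ).bcBondConfig ∅) (startCorner hE) (n + 2) =
        turnCount ((anchorData δ).bcBondConfig ∅) (startCorner hE) n := by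
  -- step 1: cross the layer edge `s((0,-(L-1)),(0,-(L-2)))`
  obtain ⟨hT1, h1, htc1⟩ := AnchorFree.step_closed hE (k' := 1) hn h
    (AnchorWired.closed_empty_tgt hδ hLδ hL1 hL (by simp; omega)) rfl
    (AnchorFree.face_of hδ hLδ hL1 (by simp [cFace, faceAt]; omega))
  -- step 2: follow `s((0,-(L-1)),(-1,-(L-1)))`
  obtain ⟨hT2, h2, htc2⟩ := AnchorFree.step_open hE (v' := ![-1, -(L - 1)]) (k' := 0) hT1 h1
    (AnchorWired.openA_tgt hδ hLδ hL1 hL _ (by simp; omega) (by simp; omega))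
    (by ext i; fin_cases i <;> simp) rfl (AnchorFree.face_of hδ hLδ hL1 (by simp [cFace, faceAt]; omega))
  exact ⟨hT2, h1, h2, htc1, by rw [htc2, htc1]; ring⟩

/-! ## The lower-left side -/

/-- **One face up the lower-left side, in the all-closed exploration.** From a visit `orb n = (G, 0)`
(`n < T`, `s(G) = -L`, `-(L - 4) ≤ d(G) ≤ L - 2`) four steps lead to `(G - e₀ + e₁, 0)` with the same turn
count: follow the frozen-open `s(G, G + e₁)`, cross the layer edges `s(G + e₁, G + e₀ + e₁)`,
`s(G + e₁, G + 2e₁)`, follow the frozen-open `s(G + e₁, G - e₀ + e₁)` (turns `-1, +1, +1, -1`; the darts in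
between are `(G + e₁, 3)`, `(G + e₁, 0)`, `(G + e₁, 1) = (G' + e₀, 1)` for the next face `G' = G - e₀ + e₁`).
[cite: Smirnov2001, §2] -/
theorem shift_LL {G : Site 2} (hs : G 0 + G 1 = -L) (hd : G 0 - G 1 ≤ L - 2) (hd' : -(L - 4) ≤ G 0 - G 1)
    {n : ℕ} (hn : n < exitTime hE ∅) (h : cornerOrbit ((anchorData δ).bcBondConfig ∅) (startCorner hE) n = (G, 0)) :
    n + 4 < exitTime hE ∅ ∧
      cornerOrbit ((anchorData δ).bcBondConfig ∅) (startCorner hE) (n + 4) = (G - cornerUnit 0 + cornerUnit 1, 0) ∧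
      turnCount ((anchorData δ).bcBondConfig ∅) (startCorner hE) (n + 4) =
        turnCount ((anchorData δ).bcBondConfig ∅) (startCorner hE) n := by
  -- step 1: follow `s(G, G + e₁)`
  obtain ⟨hT1, h1, htc1⟩ := AnchorFree.step_open hE (v' := G + cornerUnit 1) (k' := 3) hn h
    (AnchorWired.openA_tgt hδ hLδ hL1 hL _ (by omega) (by simp; omega))
    (by ext i; fin_cases i <;> simp) rfl (AnchorFree.face_of hδ hLδ hL1 (by simp [cFace, faceAt]; omega))
  -- step 2: cross the layer edge `s(G + e₁, G + e₀ + e₁)`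
  obtain ⟨hT2, h2, htc2⟩ := AnchorFree.step_closed hE (k' := 0) hT1 h1
    (AnchorWired.closed_empty_tgt hδ hLδ hL1 hL (by simp; omega)) rfl
    (AnchorFree.face_of hδ hLδ hL1 (by simp [cFace, faceAt]; omega))
  -- step 3: cross the layer edge `s(G + e₁, G + 2e₁)`
  obtain ⟨hT3, h3, htc3⟩ := AnchorFree.step_closed hE (k' := 1) hT2 h2
    (AnchorWired.closed_empty_tgt hδ hLδ hL1 hL (by simp; omega)) rfl
    (AnchorFree.face_of hδ hLδ hL1 (by simp [cFace, faceAt]; omega))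
  -- step 4: follow `s(G + e₁, G - e₀ + e₁)`
  obtain ⟨hT4, h4, htc4⟩ := AnchorFree.step_open hE (v' := G - cornerUnit 0 + cornerUnit 1) (k' := 0) hT3 h3
    (AnchorWired.openA_tgt hδ hLδ hL1 hL _ (by simp; omega) (by simp; omega))
    (by ext i; fin_cases i <;> simp [sub_eq_add_neg]) rfl
    (AnchorFree.face_of hδ hLδ hL1 (by simp [cFace, faceAt]; omega))
  refine ⟨hT4, h4, ?_⟩
  rw [htc4, htc3, htc2, htc1]; ring

/-- **Every leaving dart `(G, 0)` of the lower-left wired side is visited by the all-closed exploration,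
with turn count `-2`.** By induction on `m`, for the face `G` with `s(G) = -L` and
`d(G) = L - 2 - 2m ≥ -(L - 2)`: for `m = 0` (`G₀ = (-1,-(L-1))`) this is `orbit_LR_end` followed by
`orbit_bottom`; the step is `shift_LL` at the previous face `G + e₀ - e₁`. [cite: Smirnov2010, proof of Lemma 4.5] -/
theorem orbit_LL (m : ℕ) : ∀ G : Site 2, G 0 + G 1 = -L → G 0 - G 1 + 2 * m = L - 2 → -(L - 2) ≤ G 0 - G 1 →
    ∃ n < exitTime hE ∅, cornerOrbit ((anchorData δ).bcBondConfig ∅) (startCorner hE) n = (G, 0) ∧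
      turnCount ((anchorData δ).bcBondConfig ∅) (startCorner hE) n = -2 := by
  induction m with
  | zero =>
    intro G hs hd _
    push_cast at hd
    obtain ⟨n, hn, h, htc⟩ := orbit_LR_end hδ hLδ hL1 hL hE
    obtain ⟨hn2, -, h2, -, htc2⟩ := orbit_bottom hδ hLδ hL1 hL hE hn h
    obtain rfl : G = ![-1, -(L - 1)] := Site.eq_iff_two.2 ⟨by simp; omega, by simp; omega⟩
    exact ⟨n + 2, hn2, h2, htc2.trans htc⟩
  | succ m ih =>
    intro G hs hd hd'
    push_cast at hd
    -- the previous face `G + e₀ - e₁` of the side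
    obtain ⟨n, hn, h, htc⟩ := ih (G + cornerUnit 0 - cornerUnit 1) (by simp; omega) (by simp; omega)
      (by simp; omega)
    obtain ⟨hn4, h4, htc4⟩ := shift_LL hδ hLδ hL1 hL hE (G := G + cornerUnit 0 - cornerUnit 1)
      (by simp; omega) (by simp; omega) (by simp; omega) hn h
    have hG : G + cornerUnit 0 - cornerUnit 1 - cornerUnit 0 + cornerUnit 1 = G := by abel
    rw [hG] at h4
    exact ⟨n + 4, hn4, h4, htc4.trans htc⟩

/-- **The lower-left side, by coordinates**: every `(G, 0)` with `s(G) = -L`, `|d(G)| ≤ L - 2` is visited by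
the all-closed exploration with turn count `-2` (`d(G) ≡ L (mod 2)` as `s + d` is even).
[cite: Smirnov2010, proof of Lemma 4.5] -/
theorem orbit_LL_of_abs {G : Site 2} (hs : G 0 + G 1 = -L) (hd : |G 0 - G 1| ≤ L - 2) :
    ∃ n < exitTime hE ∅, cornerOrbit ((anchorData δ).bcBondConfig ∅) (startCorner hE) n = (G, 0) ∧
      turnCount ((anchorData δ).bcBondConfig ∅) (startCorner hE) n = -2 := by
  rw [abs_le] at hd
  obtain ⟨m, hm⟩ := Int.eq_ofNat_of_zero_le (show (0 : ℤ) ≤ -1 - G 0 by omega)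
  exact orbit_LL hδ hLδ hL1 hL hE m G hs (by omega) (by omega)

/-- **The end of the lower-left side.** The all-closed exploration visits the leaving dart
`((-(L-1), -1), 0)` of the last face `(-(L-1), -1)` (`s = -L`, `d = -(L - 2)`) of the lower-left wired side,
with turn count `-2` — the hand-over point to the upper-left side. [cite: Smirnov2010, proof of Lemma 4.5] -/
theorem orbit_LL_end : ∃ n < exitTime hE ∅,
    cornerOrbit ((anchorData δ).bcBondConfig ∅) (startCorner hE) n = ((![-(L - 1), -1] : Site 2), 0) ∧
      turnCount ((anchorData δ).bcBondConfig ∅) (startCorner hE) n = -2 :=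
  orbit_LL_of_abs hδ hLδ hL1 hL hE (by simp; omega) (by simp [abs_le]; omega)

end Level

end AnchorWiredEmpty

/-- **Registered one-line form `stub_anchor_wiredOrbitEmpty`** of `AnchorWiredEmpty.orbit_LL_of_abs` (shared
helper of the wired-side phase packages `stub_anchorWiredPhaseLL/UL` of stub `stub_anchorMoment_of_IP`): at
level `L ≥ 4` the all-closed exploration of the concrete anchor data visits every leaving dart `(G, 0)` of the
lower-left wired side (`G₀ + G₁ = -L`, `|G₀ - G₁| ≤ L - 2`) with turn count `-2`.
[cite: Smirnov2010, proof of Lemma 4.5] -/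
theorem stub_anchor_wiredOrbitEmpty : ∀ (δ : ℝ) (L : ℤ) (hE : (anchorData δ).IsZdAdmissible), 0 < δ → (L : ℝ) * δ < 2 → 2 ≤ ((L : ℝ) + 1) * δ → 4 ≤ L → ∀ G : Site 2, G 0 + G 1 = -L → |G 0 - G 1| ≤ L - 2 → ∃ n < exitTime hE ∅, cornerOrbit ((anchorData δ).bcBondConfig ∅) (startCorner hE) n = (G, 0) ∧ turnCount ((anchorData δ).bcBondConfig ∅) (startCorner hE) n = -2 :=
  fun _ _ hE hδ hLδ hL1 hL _ hs hd => AnchorWiredEmpty.orbit_LL_of_abs hδ hLδ hL1 hL hE hs hd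

end Summit.CriticalPhenomena.CardyFormulaZ2.Theorems.ParafermionFamiliesToSLESix.StripAnchored

end
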